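import Summits.AtomisticToContinuum.Crystallization.Theorems.ChargedEnergyGap.Negative.BlocksLocal

/-!
# Crux `PhononSlackCertificates.NearFarGlueR` (stmt-AtomisticToContinuum-14970), line `Sketch`:
# stub `stub_periodicInsertion` — the energy identity of single-orbit INSERTION on the torus

The e*-free REPAIR form of the line's residual compares a periodic configuration `P` of `ℝ³`
with periodic configurations `P'` obtained from it by surgery.  The basic surgery inserts one
point `p ∉ P.points` together with all its translates: `P'` has the periods of `P` and motif
`insert p P.motif`, so that `P'.points = P.points ∪ (p + G)` (`exists_insert_periodicConfiguration`;
read backwards it is single-orbit REMOVAL, `exists_erase_periodicConfiguration`).  This file proves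
the exact Lennard-Jones energy identity of that surgery (`stub_periodicInsertion`): with
`n = #P.motif`, `e(Q) = (2 #F)⁻¹ Σ_{x ∈ F} Σ'_{y ∈ Q.points, y ≠ x} V(|x − y|)`
(`PeriodicConfiguration.energyPerParticle`, `Blocks.siteSum`),

  `2 (n + 1) · e(P') = 2 n · e(P) + 2 · W_p + T`,
  `W_p = Σ'_{q ∈ P.points, q ≠ p} V(|p − q|)`,  `T = Σ'_{g ∈ G, g ≠ 0} V(|g|)`.

PROOF.  All lattice sums below are absolutely summable (`d = 3 < 6`,
`PeriodicConfiguration.summable_lennardJones_dist_three` for `P'`, sub-families by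
`Summable.comp_injective`).  (1) Row of an old motif point `x`: the other points of `P'` are the
other points of `P` and, disjointly, the orbit `p + G` (`p + g ∈ P.points` would put `p` in
`P.points`), so `siteSum P' x = siteSum P x + Σ'_{g ∈ G} V(|x − (p + g)|)`
(`Summable.tsum_union_disjoint`, `tsum_image`).  (2) Summed over `x ∈ P.motif` the second terms
give `W_p`: re-index `g ↦ −g`, `|x − (p − g)| = |p − (x + g)|`, and `(x, g) ↦ x + g` is a
bijection `P.motif × G ≃ P.points` (`Summable.tsum_prod'`).  (3) Row of the new point:
`siteSum P' p = W_p + T` (`|p − (p + g)| = |g|`).  (4) `2 #F e(Q) = Σ_{x ∈ F} siteSum Q x`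
(`Blocks.sum_siteSum_eq`) and `Finset.sum_insert`.  No definition, no named fact; all `[folklore]`.
-/

noncomputable section

namespace Summit.AtomisticToContinuum.Crystallization.Theorems.PhononSlackCertificatesNearFarGlueR

open scoped BigOperators Classical
open Literature.MathematicalPhysics.StatisticalMechanics Literature.Geometry.DiscreteGeometry
open Summit.AtomisticToContinuum.Crystallization.Theorems.ChargedEnergyGapNegative

/-! ## Inserting and erasing one orbit: the configurations -/

/-- **Inserting one orbit.**  If `p` is inequivalent modulo the periods to every motif point of
`P` (equivalently `p ∉ P.points`), then `insert p P.motif` with the periods of `P` is a periodic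
configuration `P'` with `P'.points = P.points ∪ (p + G)`. [folklore] -/
theorem exists_insert_periodicConfiguration (P : PeriodicConfiguration 3)
    (p : EuclideanSpace ℝ (Fin 3)) (hp : ∀ y ∈ P.motif, p - y ∉ P.lattice) :
    ∃ P' : PeriodicConfiguration 3, P'.motif = insert p P.motif ∧
      (∀ g : EuclideanSpace ℝ (Fin 3), g ∈ P'.lattice ↔ g ∈ P.lattice) ∧
      ∀ q : EuclideanSpace ℝ (Fin 3),
        q ∈ P'.points ↔ (q ∈ P.points ∨ ∃ g ∈ P.lattice, q = p + g) := by
  refine ⟨⟨P.lattice, P.discrete, P.isZLattice, insert p P.motif, Finset.insert_nonempty p _,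
    fun x hx y hy hxy => ?_⟩, rfl, fun g => Iff.rfl, fun q => ⟨?_, ?_⟩⟩
  · rcases Finset.mem_insert.1 hx with rfl | hx'
    · rcases Finset.mem_insert.1 hy with rfl | hy'
      · rfl
      · exact absurd hxy (hp y hy')
    · rcases Finset.mem_insert.1 hy with rfl | hy'
      · refine absurd ?_ (hp x hx')
        have h := P.lattice.neg_mem hxy
        rwa [neg_sub] at h
      · exact P.eq_of_sub_mem x hx' y hy' hxy
  · rintro ⟨y, hy, g, hg, rfl⟩
    rcases Finset.mem_insert.1 hy with rfl | hy'
    · exact Or.inr ⟨g, hg, rfl⟩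
    · exact Or.inl ⟨y, hy', g, hg, rfl⟩
  · rintro (⟨y, hy, g, hg, rfl⟩ | ⟨g, hg, rfl⟩)
    · exact ⟨y, Finset.mem_insert_of_mem hy, g, hg, rfl⟩
    · exact ⟨p, Finset.mem_insert_self p _, g, hg, rfl⟩

/-- `p ∉ P.points` is the same as: `p` is inequivalent modulo the periods to every motif point.
[folklore] -/
theorem periodicInsertion_not_mem_points_iff (P : PeriodicConfiguration 3)
    (p : EuclideanSpace ℝ (Fin 3)) :
    p ∉ P.points ↔ ∀ y ∈ P.motif, p - y ∉ P.lattice := by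
  constructor
  · intro hp y hy hmem
    exact hp ⟨y, hy, p - y, hmem, by abel⟩
  · rintro hp ⟨y, hy, g, hg, rfl⟩
    exact hp y hy (by simpa using hg)

/-- Every point of a periodic configuration of `ℝ³` is isolated in it, quantitatively: some
`ρ > 0` bounds from below its distance to every other point (local finiteness;
`Blocks.nearestDist_pt_pos`). [folklore] -/
theorem periodicInsertion_exists_pos_le_dist (P : PeriodicConfiguration 3)
    {w : EuclideanSpace ℝ (Fin 3)} (hw : w ∈ P.points) :
    ∃ ρ : ℝ, 0 < ρ ∧ ∀ q ∈ P.points, q ≠ w → ρ ≤ dist w q :=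
  ⟨nearestDist (Blocks.ptConfig P) ⟨w, hw⟩, Blocks.nearestDist_pt_pos P ⟨w, hw⟩,
    fun q hq hne => nearestDist_le_dist (Blocks.ptConfig P) (j := ⟨w, hw⟩) (k := ⟨q, hq⟩)
      fun h => hne (congrArg Subtype.val h)⟩

/-- **Erasing one orbit.**  If `w ∈ P.motif` and the motif has at least two points, then
`P.motif.erase w` with the periods of `P` is a periodic configuration `P₀` with
`P₀.points = P.points ∖ (w + G)`; moreover `P` is recovered from `P₀` by inserting the orbit of
`w` (`P.motif = insert w P₀.motif`, `P.points = P₀.points ∪ (w + G)`), and `w` is at distance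
`≥ ρ > 0` from `P₀.points` — so the insertion identity `stub_periodicInsertion` applies to
`(P₀, P, w)` and reads as the energy identity of single-orbit REMOVAL. [folklore] -/
theorem exists_erase_periodicConfiguration (P : PeriodicConfiguration 3)
    {w : EuclideanSpace ℝ (Fin 3)} (hw : w ∈ P.motif) (h2 : 2 ≤ P.motif.card) :
    ∃ P₀ : PeriodicConfiguration 3, P₀.motif = P.motif.erase w ∧
      (∀ g : EuclideanSpace ℝ (Fin 3), g ∈ P₀.lattice ↔ g ∈ P.lattice) ∧
      (∀ q : EuclideanSpace ℝ (Fin 3),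
        q ∈ P₀.points ↔ (q ∈ P.points ∧ ¬ ∃ g ∈ P.lattice, q = w + g)) ∧
      P.motif = insert w P₀.motif ∧
      (∀ q : EuclideanSpace ℝ (Fin 3),
        q ∈ P.points ↔ (q ∈ P₀.points ∨ ∃ g ∈ P₀.lattice, q = w + g)) ∧
      ∃ ρ : ℝ, 0 < ρ ∧ ∀ q ∈ P₀.points, ρ ≤ dist w q := by
  have hne : (P.motif.erase w).Nonempty :=
    Finset.card_pos.1 (by rw [Finset.card_erase_of_mem hw]; omega)
  -- a motif point one of whose translates lies on the orbit of `w` is `w`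
  have key : ∀ y ∈ P.motif, ∀ g' ∈ P.lattice, (∃ g ∈ P.lattice, y + g' = w + g) → y = w := by
    rintro y hy g' hg' ⟨g, hg, h⟩
    refine P.eq_of_sub_mem y hy w hw ?_
    have hsub : y - w = g - g' := by
      rw [sub_eq_sub_iff_add_eq_add, h, add_comm]
    rw [hsub]
    exact P.lattice.sub_mem hg hg'
  -- the sub-configuration and its point set
  obtain ⟨P₀, h0m, h0l, h0p⟩ : ∃ P₀ : PeriodicConfiguration 3, P₀.motif = P.motif.erase w ∧
      (∀ g : EuclideanSpace ℝ (Fin 3), g ∈ P₀.lattice ↔ g ∈ P.lattice) ∧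
      ∀ q : EuclideanSpace ℝ (Fin 3),
        q ∈ P₀.points ↔ (q ∈ P.points ∧ ¬ ∃ g ∈ P.lattice, q = w + g) := by
    refine ⟨⟨P.lattice, P.discrete, P.isZLattice, P.motif.erase w, hne, fun x hx y hy h =>
      P.eq_of_sub_mem x (Finset.mem_of_mem_erase hx) y (Finset.mem_of_mem_erase hy) h⟩,
      rfl, fun g => Iff.rfl, fun q => ⟨?_, ?_⟩⟩
    · rintro ⟨y, hy, g', hg', rfl⟩
      have hy' := Finset.mem_erase.1 hy
      exact ⟨⟨y, hy'.2, g', hg', rfl⟩, fun hex => hy'.1 (key y hy'.2 g' hg' hex)⟩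
    · rintro ⟨⟨y, hy, g', hg', rfl⟩, hno⟩
      exact ⟨y, Finset.mem_erase.2 ⟨fun hyw => hno ⟨g', hg', by rw [hyw]⟩, hy⟩, g', hg', rfl⟩
  refine ⟨P₀, h0m, h0l, h0p, ?_, fun q => ⟨fun hq => ?_, ?_⟩, ?_⟩
  · rw [h0m]
    exact (Finset.insert_erase hw).symm
  · by_cases hex : ∃ g ∈ P.lattice, q = w + g
    · obtain ⟨g, hg, rfl⟩ := hex
      exact Or.inr ⟨g, (h0l g).2 hg, rfl⟩
    · exact Or.inl ((h0p q).2 ⟨hq, hex⟩)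
  · rintro (hq | ⟨g, hg, rfl⟩)
    · exact ((h0p q).1 hq).1
    · exact P.add_mem_points (P.mem_points_of_mem_motif hw) ((h0l g).1 hg)
  · obtain ⟨ρ, hρ, hρ'⟩ :=
      periodicInsertion_exists_pos_le_dist P (P.mem_points_of_mem_motif hw)
    refine ⟨ρ, hρ, fun q hq => ?_⟩
    have hq' := (h0p q).1 hq
    exact hρ' q hq'.1 fun hqw => hq'.2 ⟨0, P.lattice.zero_mem, by rw [hqw, add_zero]⟩

/-! ## Lattice-sum bookkeeping -/

-- adapted from Summits/.../ReggeStarCoercivityDefectFreeCrystallizesJunkStrippingEnergy.lean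
-- (`summable_lennardJones_of_subset`, `tsum_orbits_eq`) and
-- Summits/.../ChessboardParticlePlanesLjBilayerHcpStubEnergyIdentity.lean (`energyIdentity_site`)

/-- Lennard-Jones fields of a periodic configuration `Q` of `ℝ³` are summable over every set of
its points other than the base point (`PeriodicConfiguration.summable_lennardJones_dist_three`,
`Summable.comp_injective`; stated with `∘ (↑)` so that uses unify structurally). [folklore] -/
theorem periodicInsertion_summable (Q : PeriodicConfiguration 3) (x : EuclideanSpace ℝ (Fin 3))
    {s : Set (EuclideanSpace ℝ (Fin 3))}
    (hs : s ⊆ {q : EuclideanSpace ℝ (Fin 3) | q ∈ Q.points ∧ q ≠ x}) :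
    Summable ((fun q : EuclideanSpace ℝ (Fin 3) => lennardJones (dist x q)) ∘ (↑) : s → ℝ) := by
  have ht : Summable ((fun q : EuclideanSpace ℝ (Fin 3) => lennardJones (dist x q)) ∘ (↑) :
      ↥{q : EuclideanSpace ℝ (Fin 3) | q ∈ Q.points ∧ q ≠ x} → ℝ) :=
    Q.summable_lennardJones_dist_three x
  have key : ∀ {f : EuclideanSpace ℝ (Fin 3) → ℝ} {t : Set (EuclideanSpace ℝ (Fin 3))},
      s ⊆ t → Summable (f ∘ (↑) : t → ℝ) → Summable (f ∘ (↑) : s → ℝ) :=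
    fun h hf => hf.comp_injective (Set.inclusion_injective h)
  exact key hs ht

/-- **Orbit decomposition of a lattice sum over `P.points`.**  The points of `P` are uniquely
`y + g` (`y ∈ P.motif`, `g ∈ G`), so a summable function sums over `P.points` as
`Σ_{y ∈ motif} Σ'_{g ∈ G}` (`Summable.tsum_prod'`). [folklore] -/
theorem periodicInsertion_tsum_points_eq (P : PeriodicConfiguration 3)
    (φ : EuclideanSpace ℝ (Fin 3) → ℝ) (hφ : Summable (φ ∘ (↑) : P.points → ℝ)) :
    ∑' q : P.points, φ q = ∑ y ∈ P.motif, ∑' g : P.lattice, φ (y + g) := by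
  let f : ↥P.motif × ↥P.lattice → P.points :=
    fun q => ⟨(q.1 : EuclideanSpace ℝ (Fin 3)) + (q.2 : EuclideanSpace ℝ (Fin 3)),
      q.1, q.1.2, q.2, q.2.2, rfl⟩
  have hf : Function.Bijective f := by
    constructor
    · rintro ⟨y, g⟩ ⟨y', g'⟩ h
      have h' : (y : EuclideanSpace ℝ (Fin 3)) + g = y' + g' := congrArg Subtype.val h
      have hsub : (y : EuclideanSpace ℝ (Fin 3)) - y' = g' - g := by
        rw [sub_eq_sub_iff_add_eq_add, h', add_comm]
      have hmem : (y : EuclideanSpace ℝ (Fin 3)) - y' ∈ P.lattice := by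
        rw [hsub]; exact P.lattice.sub_mem g'.2 g.2
      have hy : (y : EuclideanSpace ℝ (Fin 3)) = y' := P.eq_of_sub_mem _ y.2 _ y'.2 hmem
      have hg : (g : EuclideanSpace ℝ (Fin 3)) = g' := by
        rw [hy] at h'; exact add_left_cancel h'
      exact Prod.ext (Subtype.ext hy) (Subtype.ext hg)
    · rintro ⟨z, y, hy, g, hg, rfl⟩
      exact ⟨(⟨y, hy⟩, ⟨g, hg⟩), rfl⟩
  let e : ↥P.motif × ↥P.lattice ≃ P.points := Equiv.ofBijective f hf
  rw [← e.tsum_eq]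
  have hsum : Summable fun q : ↥P.motif × ↥P.lattice => φ (e q) := e.summable_iff.2 hφ
  rw [hsum.tsum_prod' (fun b => hsum.prod_factor b), tsum_fintype,
    ← Finset.sum_coe_sort P.motif (fun y => ∑' g : P.lattice, φ (y + g))]
  rfl

/-- **Binding of the new point, orbit by orbit.**  For `p ∉ P.points`,
`Σ_{x ∈ P.motif} Σ'_{g ∈ G} V(|x − (p + g)|) = Σ'_{q ∈ P.points, q ≠ p} V(|p − q|)`
(re-index `g ↦ −g` and decompose `P.points` into orbits). [folklore] -/
theorem periodicInsertion_cross (P : PeriodicConfiguration 3) {p : EuclideanSpace ℝ (Fin 3)}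
    (hpS : p ∉ P.points) :
    ∑ x ∈ P.motif, ∑' g : P.lattice, lennardJones (dist x (p + g)) =
      ∑' q : {q : EuclideanSpace ℝ (Fin 3) // q ∈ P.points ∧ q ≠ p}, lennardJones (dist p q.1) := by
  have hre : ∀ x ∈ P.motif, ∑' g : P.lattice, lennardJones (dist x (p + g)) =
      ∑' g : P.lattice, lennardJones (dist p (x + g)) := fun x _ => by
    rw [← (Equiv.neg P.lattice).tsum_eq]
    refine tsum_congr fun g => ?_
    simp only [Equiv.neg_apply, NegMemClass.coe_neg]
    rw [dist_comm p, dist_eq_norm, dist_eq_norm]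
    congr 2
    abel
  have hW : Summable ((fun q : EuclideanSpace ℝ (Fin 3) => lennardJones (dist p q)) ∘ (↑) :
      P.points → ℝ) :=
    periodicInsertion_summable P p fun q hq => ⟨hq, fun h => hpS (h ▸ hq)⟩
  rw [Finset.sum_congr rfl hre,
    ← periodicInsertion_tsum_points_eq P (fun q => lennardJones (dist p q)) hW]
  refine tsum_congr_subtype (fun q => lennardJones (dist p q)) fun q => ?_
  exact ⟨fun hq => ⟨hq, fun h => hpS (h ▸ hq)⟩, fun h => h.1⟩

/-- **Row of an old point.**  If `P'.points = P.points ∪ (p + G)` with `p ∉ P.points`, then at a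
point `x ∈ P.points` the site sum of `P'` is the site sum of `P` plus the field of the new orbit:
`siteSum P' x = siteSum P x + Σ'_{g ∈ G} V(|x − (p + g)|)`. [folklore] -/
theorem periodicInsertion_row_old (P P' : PeriodicConfiguration 3) {p : EuclideanSpace ℝ (Fin 3)}
    (hpS : p ∉ P.points)
    (hpts : ∀ q : EuclideanSpace ℝ (Fin 3),
      q ∈ P'.points ↔ (q ∈ P.points ∨ ∃ g ∈ P.lattice, q = p + g))
    {x : EuclideanSpace ℝ (Fin 3)} (hx : x ∈ P.points) :
    Blocks.siteSum P' lennardJones x =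
      Blocks.siteSum P lennardJones x + ∑' g : P.lattice, lennardJones (dist x (p + g)) := by
  have hpg : ∀ g ∈ P.lattice, p + g ∉ P.points := fun g hg h =>
    hpS (by simpa using P.add_mem_points h (P.lattice.neg_mem hg))
  set A : Set (EuclideanSpace ℝ (Fin 3)) := {q | q ∈ P.points ∧ q ≠ x} with hA
  set B : Set (EuclideanSpace ℝ (Fin 3)) :=
    (fun g : EuclideanSpace ℝ (Fin 3) => p + g) '' (P.lattice : Set (EuclideanSpace ℝ (Fin 3)))
    with hB
  have hset : {q : EuclideanSpace ℝ (Fin 3) | q ∈ P'.points ∧ q ≠ x} = A ∪ B := by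
    ext q
    simp only [hA, hB, Set.mem_setOf_eq, Set.mem_union, Set.mem_image, SetLike.mem_coe, hpts]
    constructor
    · rintro ⟨hq | ⟨g, hg, rfl⟩, hne⟩
      · exact Or.inl ⟨hq, hne⟩
      · exact Or.inr ⟨g, hg, rfl⟩
    · rintro (⟨hq, hne⟩ | ⟨g, hg, rfl⟩)
      · exact ⟨Or.inl hq, hne⟩
      · exact ⟨Or.inr ⟨g, hg, rfl⟩, fun h => hpg g hg (h ▸ hx)⟩
  have hdisj : Disjoint A B :=
    Set.disjoint_left.2 (by rintro q ⟨hq, -⟩ ⟨g, hg, rfl⟩; exact hpg g hg hq)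
  have hsA : Summable ((fun q : EuclideanSpace ℝ (Fin 3) => lennardJones (dist x q)) ∘ (↑) :
      A → ℝ) :=
    periodicInsertion_summable P' x (hset ▸ Set.subset_union_left)
  have hsB : Summable ((fun q : EuclideanSpace ℝ (Fin 3) => lennardJones (dist x q)) ∘ (↑) :
      B → ℝ) :=
    periodicInsertion_summable P' x (hset ▸ Set.subset_union_right)
  have e1 : Blocks.siteSum P' lennardJones x = ∑' q : ↥(A ∪ B), lennardJones (dist x q.1) :=
    (tsum_congr_set_coe (fun q => lennardJones (dist x q)) hset :)
  have e2 : ∑' q : ↥(A ∪ B), lennardJones (dist x q.1) =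
      Blocks.siteSum P lennardJones x + ∑' q : B, lennardJones (dist x q.1) :=
    (hsA.tsum_union_disjoint (f := fun q => lennardJones (dist x q)) hdisj hsB :)
  have e3 : ∑' q : B, lennardJones (dist x q.1) =
      ∑' g : P.lattice, lennardJones (dist x (p + g)) :=
    (tsum_image (fun q => lennardJones (dist x q))
      ((add_right_injective p).injOn (s := (P.lattice : Set (EuclideanSpace ℝ (Fin 3))))) :)
  rw [e1, e2, e3]

/-- **Row of the new point.**  If `P'.points = P.points ∪ (p + G)` with `p ∉ P.points`, then
`siteSum P' p = Σ'_{q ∈ P.points, q ≠ p} V(|p − q|) + Σ'_{g ∈ G, g ≠ 0} V(|g|)`. [folklore] -/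
theorem periodicInsertion_row_new (P P' : PeriodicConfiguration 3) {p : EuclideanSpace ℝ (Fin 3)}
    (hpS : p ∉ P.points)
    (hpts : ∀ q : EuclideanSpace ℝ (Fin 3),
      q ∈ P'.points ↔ (q ∈ P.points ∨ ∃ g ∈ P.lattice, q = p + g)) :
    Blocks.siteSum P' lennardJones p =
      (∑' q : {q : EuclideanSpace ℝ (Fin 3) // q ∈ P.points ∧ q ≠ p}, lennardJones (dist p q.1)) +
        ∑' g : {g : EuclideanSpace ℝ (Fin 3) // g ∈ P.lattice ∧ g ≠ 0}, lennardJones ‖g.1‖ := by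
  have hpg : ∀ g ∈ P.lattice, p + g ∉ P.points := fun g hg h =>
    hpS (by simpa using P.add_mem_points h (P.lattice.neg_mem hg))
  set A : Set (EuclideanSpace ℝ (Fin 3)) := {q | q ∈ P.points ∧ q ≠ p} with hA
  set L0 : Set (EuclideanSpace ℝ (Fin 3)) := {g | g ∈ P.lattice ∧ g ≠ 0} with hL0
  set B : Set (EuclideanSpace ℝ (Fin 3)) := (fun g : EuclideanSpace ℝ (Fin 3) => p + g) '' L0
    with hB
  have hset : {q : EuclideanSpace ℝ (Fin 3) | q ∈ P'.points ∧ q ≠ p} = A ∪ B := by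
    ext q
    simp only [hA, hB, hL0, Set.mem_setOf_eq, Set.mem_union, Set.mem_image, hpts]
    constructor
    · rintro ⟨hq | ⟨g, hg, rfl⟩, hne⟩
      · exact Or.inl ⟨hq, hne⟩
      · exact Or.inr ⟨g, ⟨hg, fun h0 => hne (by rw [h0, add_zero])⟩, rfl⟩
    · rintro (⟨hq, hne⟩ | ⟨g, ⟨hg, hg0⟩, rfl⟩)
      · exact ⟨Or.inl hq, hne⟩
      · exact ⟨Or.inr ⟨g, hg, rfl⟩, fun h => hg0 (by simpa using h)⟩
  have hdisj : Disjoint A B :=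
    Set.disjoint_left.2 (by rintro q ⟨hq, -⟩ ⟨g, ⟨hg, -⟩, rfl⟩; exact hpg g hg hq)
  have hsA : Summable ((fun q : EuclideanSpace ℝ (Fin 3) => lennardJones (dist p q)) ∘ (↑) :
      A → ℝ) :=
    periodicInsertion_summable P' p (hset ▸ Set.subset_union_left)
  have hsB : Summable ((fun q : EuclideanSpace ℝ (Fin 3) => lennardJones (dist p q)) ∘ (↑) :
      B → ℝ) :=
    periodicInsertion_summable P' p (hset ▸ Set.subset_union_right)
  have e1 : Blocks.siteSum P' lennardJones p = ∑' q : ↥(A ∪ B), lennardJones (dist p q.1) :=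
    (tsum_congr_set_coe (fun q => lennardJones (dist p q)) hset :)
  have e2 : ∑' q : ↥(A ∪ B), lennardJones (dist p q.1) =
      (∑' q : {q : EuclideanSpace ℝ (Fin 3) // q ∈ P.points ∧ q ≠ p},
          lennardJones (dist p q.1)) + ∑' q : B, lennardJones (dist p q.1) :=
    (hsA.tsum_union_disjoint (f := fun q => lennardJones (dist p q)) hdisj hsB :)
  have e3 : ∑' q : B, lennardJones (dist p q.1) = ∑' g : L0, lennardJones (dist p (p + g)) :=
    (tsum_image (fun q => lennardJones (dist p q)) ((add_right_injective p).injOn (s := L0)) :)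
  rw [e1, e2, e3]
  congr 1
  exact tsum_congr fun g => by rw [dist_self_add_right]

/-! ## The stub -/

/-- **STUB periodicInsertion — the energy identity of single-orbit insertion.**  Let `P, P'` be
periodic configurations of `ℝ³` and `p` a point at distance `≥ ρ > 0` from `P.points` such that
`P'.motif = insert p P.motif` and `P'.points = P.points ∪ (p + G)` (`G` the periods of `P`).
Then, with `n = #P.motif`, `W_p = Σ'_{q ∈ P.points, q ≠ p} V(|p − q|)` and
`T = Σ'_{g ∈ G, g ≠ 0} V(|g|)`,
`2 (n + 1) · e(P') = 2 n · e(P) + 2 · W_p + T` for the Lennard-Jones energy per particle.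
[folklore] -/
theorem stub_periodicInsertion :
    ∀ (P P' : PeriodicConfiguration 3) (p : EuclideanSpace ℝ (Fin 3)) (ρ : ℝ), 0 < ρ →
      (∀ q ∈ P.points, ρ ≤ dist p q) → P'.motif = insert p P.motif →
      (∀ q : EuclideanSpace ℝ (Fin 3), q ∈ P'.points ↔ (q ∈ P.points ∨ ∃ g ∈ P.lattice, q = p + g)) →
      2 * ((P.motif.card : ℝ) + 1) * P'.energyPerParticle lennardJones =
        2 * (P.motif.card : ℝ) * P.energyPerParticle lennardJones
          + 2 * (∑' q : {q : EuclideanSpace ℝ (Fin 3) // q ∈ P.points ∧ q ≠ p}, lennardJones (dist p q.1))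
          + ∑' g : {g : EuclideanSpace ℝ (Fin 3) // g ∈ P.lattice ∧ g ≠ 0}, lennardJones ‖g.1‖ := by
  intro P P' p ρ hρ hρS hmotif hpts
  -- `p` is a new point: not in `P.points`, not in the motif, so `#P'.motif = #P.motif + 1`
  have hpS : p ∉ P.points := fun h => by
    have h' := hρS p h
    rw [dist_self] at h'
    exact absurd h' (not_le.2 hρ)
  have hpm : p ∉ P.motif := fun h => hpS (P.mem_points_of_mem_motif h)
  have hcard : (P'.motif.card : ℝ) = P.motif.card + 1 := by
    rw [hmotif, Finset.card_insert_of_notMem hpm, Nat.cast_add, Nat.cast_one]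
  -- `2 (n + 1) e(P') = Σ_{x ∈ insert p motif} siteSum P' x`
  have h1 : 2 * ((P.motif.card : ℝ) + 1) * P'.energyPerParticle lennardJones =
      Blocks.siteSum P' lennardJones p + ∑ x ∈ P.motif, Blocks.siteSum P' lennardJones x := by
    rw [← hcard, ← Blocks.sum_siteSum_eq, hmotif, Finset.sum_insert hpm]
  rw [h1, periodicInsertion_row_new P P' hpS hpts,
    Finset.sum_congr rfl fun x hx =>
      periodicInsertion_row_old P P' hpS hpts (P.mem_points_of_mem_motif hx),
    Finset.sum_add_distrib, Blocks.sum_siteSum_eq, periodicInsertion_cross P hpS]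
  ring

end Summit.AtomisticToContinuum.Crystallization.Theorems.PhononSlackCertificatesNearFarGlueR

end
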